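import Summits.HubbardSuperconductivity.HubbardSuperconductivity.Theorems.AnisotropyChordKnnRatioBounds
import Summits.HubbardSuperconductivity.HubbardSuperconductivity.Theorems.AnisotropyChordKnnAllNPoly
import Summits.HubbardSuperconductivity.HubbardSuperconductivity.Theorems.AnisotropyChordKnnAssembly

/-!
# Route `AnisotropyChord` / H0 rotor rung, K_{n,n} sibling of XY-LM₀: the all-`n` BOUNDS for the ratio-majorant proof of
# LEMMA C — closed forms of the block data, their `M`-reductions, and the ratio bounds `T_k = ¼`, `T_top = 4/25`
(prover seat `hubbard-h0-rotor-p1` g16; first half of the analytic all-`n` proof, completed in `…KnnAllN`)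

* closed forms: `dK_eq_of_le` / `dK_top_eq` (diagonal drops `(η/4)(2M+1)(β²_{J−1}+β²_J)`), `dK_budget_eq`;
* `M`-reductions: `cUK_le_CU0` (couplings decrease in `M`), `eta_PD0_le_pK_sub` (diagonal gaps increase in `M`, and are
  `≥ η ×` their `η = 1` value because the bare level gap is `η`-free and non-negative);
* coupling-drop bounds `dcUK_le_dK` (`≤ ⅔ d`), `dcUK_top_le` (`≤ (27/80) d` on the top link), vanished level
  `cUK_zero_le_of_shift` (`≤ 4 d_0`);
* **`ratio_hypotheses`**: with `T = ratioTall` (`¼` below the top link, `4/25` on it) the brackets of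
  `budgetCondition_of_ratioBounds` are positive and dominate the couplings, for `n ≥ 8`, `M + 4 ≤ n`, `0 < η ≤ 1`
  (from `ratioCriterion_M0`, `topCriterion_M0` of `…KnnAllNPoly`).
-/

set_option linter.dupNamespace false
set_option autoImplicit false

noncomputable section

open Finset Matrix

namespace Summit.HubbardSuperconductivity.HubbardSuperconductivity.Theorems.AnisotropyChord.Knn

/-! ## Level bookkeeping -/

/-- levels of a sector counted from the top: `J_k + 2(t − k) = n` (`t` the top index). [folklore] -/
theorem lev_add_twice_sub (n : ℕ) {M : ℤ} (hM : M.natAbs ≤ n) {k : ℕ} (hk : k ≤ numLevels n M - 1) :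
    lev n M k + 2 * (numLevels n M - 1 - k) = n := by
  have h := lev_top n hM
  unfold lev at h ⊢
  omega

/-- the levels of sector `M + 1` are `≥ M + 1 ≥ 1`. [folklore] -/
theorem succ_le_lev_succM (n M k : ℕ) : M + 1 ≤ lev n ((M : ℤ) + 1) k := by
  have := natAbs_le_lev n ((M : ℤ) + 1) k
  rwa [natAbs_natCast_succ] at this

/-! ## Closed forms and `M`-reductions of the block data -/

/-- the AM–GM coupling majorant decreases in `M`: `cU_k(M, η) ≤ η · CU0 n J_k`. [folklore] -/
theorem cUK_le_CU0 (n M : ℕ) {η : ℝ} (hη : 0 ≤ η) (k : ℕ) (hJ : lev n (M : ℤ) k + 2 ≤ n) :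
    cUK n (M : ℤ) η k ≤ η * CU0 n (lev n (M : ℤ) k) := by
  unfold cUK CU0 bSq
  set J := lev n (M : ℤ) k
  rw [if_pos (by omega), if_pos (by omega)]
  have hb1 : 0 ≤ betaSq n J := betaSq_nonneg (by omega)
  have hb2 : 0 ≤ betaSq n (J + 1) := betaSq_nonneg (by omega)
  push_cast
  have hM2 : 0 ≤ ((M : ℝ)) ^ 2 := sq_nonneg _
  nlinarith [mul_nonneg hM2 hb1, mul_nonneg hM2 hb2, mul_nonneg hη (mul_nonneg hM2 hb1),
    mul_nonneg hη (mul_nonneg hM2 hb2)]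

/-- the diagonal gap to the top increases in `M` and dominates `η ×` its `M = 0`, `η = 1` value:
`η · PD0 n J_k ≤ p_top(M, η) − p_k(M, η)` for `0 ≤ η ≤ 1`. [folklore] -/
theorem eta_PD0_le_pK_sub (n M : ℕ) (hMn : M ≤ n) {η : ℝ} (h0 : 0 ≤ η) (h1 : η ≤ 1) (k : ℕ)
    (hJ : lev n (M : ℤ) k + 2 ≤ n) :
    η * PD0 n (lev n (M : ℤ) k) ≤ pK n (M : ℤ) η (numLevels n (M : ℤ) - 1) - pK n (M : ℤ) η k := by
  have hMabs : ((M : ℤ)).natAbs ≤ n := by rw [Int.natAbs_natCast]; exact hMn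
  unfold pK PD0
  rw [lev_top n hMabs]
  set J := lev n (M : ℤ) k with hJdef
  have hn1 : 1 ≤ n := by omega
  -- the top diagonal: bSqPred n = bSq (n-1) = (n² − M²) β_{n−1}, bSq n = 0
  have etop1 : bSqPred n (M : ℤ) n = ((n : ℝ) ^ 2 - (M : ℝ) ^ 2) * betaSq n (n - 1) := by
    unfold bSqPred bSq
    rw [if_neg (by omega), if_pos (by omega)]
    have : ((n - 1 : ℕ) : ℝ) = (n : ℝ) - 1 := by rw [Nat.cast_sub hn1]; simp
    rw [this]; push_cast; ring
  have etop2 : bSq n (M : ℤ) n = 0 := by unfold bSq; rw [if_neg (by omega)]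
  have eJ : bSq n (M : ℤ) J = (((J : ℝ) + 1) ^ 2 - (M : ℝ) ^ 2) * betaSq n J := by
    unfold bSq; rw [if_pos (by omega)]; push_cast; ring
  have hbJ : betaSq n (n - 1) ≤ betaSq n J := betaSq_antitone (by omega) (by omega)
  have hbJ0 : 0 ≤ betaSq n J := betaSq_nonneg (by omega)
  have hgap : 0 ≤ (n : ℝ) * ((n : ℝ) + 1) - (J : ℝ) * ((J : ℝ) + 1) := by
    have : (J : ℝ) ≤ n := by exact_mod_cast (show J ≤ n by omega)
    nlinarith [Nat.cast_nonneg (α := ℝ) J]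
  have hM2 : 0 ≤ (M : ℝ) ^ 2 := sq_nonneg _
  rcases Nat.eq_zero_or_pos J with hJ0 | hJpos
  · -- J = 0: no `b²_{J−1}` term
    have ePred : bSqPred n (M : ℤ) J = 0 := by unfold bSqPred; rw [if_pos hJ0]
    rw [etop1, etop2, eJ, ePred]
    rw [hJ0] at hbJ hbJ0 hgap ⊢
    push_cast
    simp only [zero_pow two_ne_zero, zero_mul, sub_zero, zero_add]
    nlinarith [mul_nonneg hM2 (sub_nonneg.mpr hbJ), mul_nonneg h0 (mul_nonneg hM2 (sub_nonneg.mpr hbJ)),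
      mul_nonneg (sub_nonneg.mpr h1) hgap]
  · have ePred : bSqPred n (M : ℤ) J = (((J : ℝ)) ^ 2 - (M : ℝ) ^ 2) * betaSq n (J - 1) := by
      unfold bSqPred bSq
      rw [if_neg (by omega), if_pos (by omega)]
      have : ((J - 1 : ℕ) : ℝ) = (J : ℝ) - 1 := by rw [Nat.cast_sub hJpos]; simp
      rw [this]; push_cast; ring
    have hbP : 0 ≤ betaSq n (J - 1) := betaSq_nonneg (by omega)
    rw [etop1, etop2, eJ, ePred]
    nlinarith [mul_nonneg hM2 (sub_nonneg.mpr hbJ), mul_nonneg h0 (mul_nonneg hM2 (sub_nonneg.mpr hbJ)),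
      mul_nonneg (sub_nonneg.mpr h1) hgap, mul_nonneg h0 (mul_nonneg hM2 hbP)]

/-- closed form of the diagonal drop on a non-top level `J = J_{k'}(M+1) ≤ n − 1`:
`d_{k'} = (η/4)(2M+1)(β²_{J−1} + β²_J)`. [folklore] -/
theorem dK_eq_of_le (n M : ℕ) (η : ℝ) (k' : ℕ) (hJn : lev n ((M : ℤ) + 1) k' + 1 ≤ n) :
    dK n M η k' = η / 4 * (2 * (M : ℝ) + 1)
      * (betaSq n (lev n ((M : ℤ) + 1) k' - 1) + betaSq n (lev n ((M : ℤ) + 1) k')) := by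
  unfold dK pK
  rw [← lev_succ]
  set J := lev n ((M : ℤ) + 1) k' with hJdef
  have hJ1 : 1 ≤ J := le_trans (by omega) (succ_le_lev_succM n M k')
  have e2 := bSq_sub_bSq_succ n M J
  rw [if_pos hJn] at e2
  have e1 : bSqPred n (M : ℤ) J - bSqPred n ((M : ℤ) + 1) J = (2 * (M : ℝ) + 1) * betaSq n (J - 1) := by
    unfold bSqPred
    rw [if_neg (by omega), if_neg (by omega)]
    have := bSq_sub_bSq_succ n M (J - 1)
    rw [if_pos (by omega)] at this
    exact this
  linear_combination (η / 4) * (e1 + e2)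

/-- closed form of the TOP diagonal drop: `d_top = (η/4)(2M+1) β²_{n−1}`. [folklore] -/
theorem dK_top_eq (n M : ℕ) (η : ℝ) (hM : M + 1 ≤ n) :
    dK n M η (numLevels n ((M : ℤ) + 1) - 1) = η / 4 * (2 * (M : ℝ) + 1) * betaSq n (n - 1) := by
  have hM1abs : ((M : ℤ) + 1).natAbs ≤ n := by rw [natAbs_natCast_succ]; exact hM
  unfold dK pK
  rw [← lev_succ, lev_top n hM1abs]
  have e2 := bSq_sub_bSq_succ n M n
  rw [if_neg (by omega)] at e2
  have e1 : bSqPred n (M : ℤ) n - bSqPred n ((M : ℤ) + 1) n = (2 * (M : ℝ) + 1) * betaSq n (n - 1) := by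
    unfold bSqPred
    rw [if_neg (by omega), if_neg (by omega)]
    have := bSq_sub_bSq_succ n M (n - 1)
    rw [if_pos (by omega)] at this
    exact this
  linear_combination (η / 4) * (e1 + e2)

/-- the budget is the diagonal drop on the level `n − 2`. [folklore] -/
theorem dK_budget_eq (n M : ℕ) (η : ℝ) (hM : M + 4 ≤ n) (k' : ℕ) (hJ : lev n ((M : ℤ) + 1) k' = n - 2) :
    dK n M η k' = budget n M η := by
  rw [dK_eq_of_le n M η k' (by omega), hJ, show n - 2 - 1 = n - 3 by omega]
  unfold budget; ring

/-- `(x+y)²/(4xy) ≤ 4/3` when `0 < x ≤ y ≤ 3x`. [folklore] -/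
theorem ratio_sq_le_four_thirds {x y : ℝ} (hx : 0 < x) (hxy : x ≤ y) (hy : y ≤ 3 * x) :
    (x + y) ^ 2 / (4 * x * y) ≤ 4 / 3 := by
  have hy0 : 0 < y := lt_of_lt_of_le hx hxy
  rw [div_le_div_iff₀ (by positivity) (by norm_num)]
  nlinarith [mul_nonneg (sub_nonneg.mpr hy) (by linarith : (0:ℝ) ≤ 3 * y - x)]

/-- `(x+y)²/(4xy) ≤ 9/8` when `0 < x ≤ y ≤ 2x`. [folklore] -/
theorem ratio_sq_le_nine_eighths {x y : ℝ} (hx : 0 < x) (hxy : x ≤ y) (hy : y ≤ 2 * x) :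
    (x + y) ^ 2 / (4 * x * y) ≤ 9 / 8 := by
  have hy0 : 0 < y := lt_of_lt_of_le hx hxy
  rw [div_le_div_iff₀ (by positivity) (by norm_num)]
  nlinarith [mul_nonneg (sub_nonneg.mpr hy) (by linarith : (0:ℝ) ≤ 2 * y - x)]

/-- **coupling drop vs. diagonal drop:** `dcU ≤ ⅔ d` on every non-top coupling of sector `M+1`
(`(β²_J+β²_{J+1})/2 ≤ (β²_{J−1}+β²_J)/2` and `(x′+y′)²/(4x′y′) ≤ 4/3` since `y′ ≤ 3x′` for `J ≥ M+1`). [folklore] -/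
theorem dcUK_le_dK (n M : ℕ) {η : ℝ} (hη : 0 ≤ η) (k' : ℕ) (hJ : lev n ((M : ℤ) + 1) k' + 2 ≤ n) :
    dcUK n M η (k' + shift n M) ≤ 2 / 3 * dK n M η k' := by
  rw [dK_eq_of_le n M η k' (by omega)]
  unfold dcUK
  rw [← lev_succ]
  set J := lev n ((M : ℤ) + 1) k' with hJdef
  rw [if_pos hJ]
  have hMJ : M + 1 ≤ J := succ_le_lev_succM n M k'
  have hx : 0 < xLev J M := xLev_pos hMJ
  have hxy : xLev J M ≤ yLev J M := by unfold xLev yLev; nlinarith [Nat.cast_nonneg (α := ℝ) J]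
  have hy3 : yLev J M ≤ 3 * xLev J M := by
    unfold xLev yLev
    have : (M : ℝ) + 1 ≤ J := by exact_mod_cast hMJ
    nlinarith [Nat.cast_nonneg (α := ℝ) M]
  have hg := ratio_sq_le_four_thirds hx hxy hy3
  have hg0 : 0 ≤ (xLev J M + yLev J M) ^ 2 / (4 * xLev J M * yLev J M) := by
    have := (yLev_pos (by omega : M ≤ J)).le; positivity
  have hb1 : betaSq n (J + 1) ≤ betaSq n (J - 1) := betaSq_antitone (by omega) (by omega)
  have hbJ : 0 ≤ betaSq n J := betaSq_nonneg (by omega)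
  have hbJ1 : 0 ≤ betaSq n (J + 1) := betaSq_nonneg (by omega)
  have hfac : 0 ≤ η / 4 * (2 * (M : ℝ) + 1) := by positivity
  have hsum : (betaSq n J + betaSq n (J + 1)) / 2 * ((xLev J M + yLev J M) ^ 2 / (4 * xLev J M * yLev J M))
      ≤ 2 / 3 * (betaSq n (J - 1) + betaSq n J) := by
    calc (betaSq n J + betaSq n (J + 1)) / 2 * ((xLev J M + yLev J M) ^ 2 / (4 * xLev J M * yLev J M))
        ≤ (betaSq n J + betaSq n (J + 1)) / 2 * (4 / 3) := mul_le_mul_of_nonneg_left hg (by positivity)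
      _ ≤ 2 / 3 * (betaSq n (J - 1) + betaSq n J) := by linarith
  calc η / 4 * (2 * (M : ℝ) + 1) * ((betaSq n J + betaSq n (J + 1)) / 2)
        * ((xLev J M + yLev J M) ^ 2 / (4 * xLev J M * yLev J M))
      = η / 4 * (2 * (M : ℝ) + 1) * ((betaSq n J + betaSq n (J + 1)) / 2
        * ((xLev J M + yLev J M) ^ 2 / (4 * xLev J M * yLev J M))) := by ring
    _ ≤ η / 4 * (2 * (M : ℝ) + 1) * (2 / 3 * (betaSq n (J - 1) + betaSq n J)) := mul_le_mul_of_nonneg_left hsum hfac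
    _ = 2 / 3 * (η / 4 * (2 * (M : ℝ) + 1) * (betaSq n (J - 1) + betaSq n J)) := by ring

/-- **coupling drop on the TOP link vs. the budget:** `dcU_{n−2} ≤ (27/80)·d_{n−2}` (`M + 4 ≤ n`: `y′ ≤ 2x′`, and
`β²_{n−2}+β²_{n−1} ≤ (3/5)(β²_{n−3}+β²_{n−2})`). [folklore] -/
theorem dcUK_top_le (n M : ℕ) {η : ℝ} (hη : 0 ≤ η) (hM : M + 4 ≤ n) (k' : ℕ) (hJ : lev n ((M : ℤ) + 1) k' = n - 2) :
    dcUK n M η (k' + shift n M) ≤ 27 / 80 * dK n M η k' := by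
  rw [dK_eq_of_le n M η k' (by omega)]
  unfold dcUK
  rw [← lev_succ]
  set J := lev n ((M : ℤ) + 1) k' with hJdef
  rw [if_pos (by omega)]
  have hMJ : M + 1 ≤ J := succ_le_lev_succM n M k'
  have hx : 0 < xLev J M := xLev_pos hMJ
  have hxy : xLev J M ≤ yLev J M := by unfold xLev yLev; nlinarith [Nat.cast_nonneg (α := ℝ) J]
  have hy2 : yLev J M ≤ 2 * xLev J M := by
    unfold xLev yLev
    have h3 : (M : ℝ) + 1 ≤ (J : ℝ) - 1 := by
      have : ((M + 2 : ℕ) : ℝ) ≤ J := by exact_mod_cast (show M + 2 ≤ J by omega)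
      push_cast at this; linarith
    have h4 : (2 : ℝ) ≤ J := by exact_mod_cast (show 2 ≤ J by omega)
    have hsq : ((M : ℝ) + 1) ^ 2 ≤ ((J : ℝ) - 1) ^ 2 := pow_le_pow_left₀ (by positivity) h3 2
    nlinarith [Nat.cast_nonneg (α := ℝ) M]
  have hg := ratio_sq_le_nine_eighths hx hxy hy2
  have hf : betaSq n (n - 2) + betaSq n (n - 1) ≤ 3 / 5 * (betaSq n (n - 3) + betaSq n (n - 2)) := fOne_le (by omega)
  have e1 : J + 1 = n - 1 := by omega
  have e2 : J - 1 = n - 3 := by omega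
  have e3 : betaSq n J = betaSq n (n - 2) := by rw [hJ]
  rw [e1, e2, e3]
  have hb2 : 0 ≤ betaSq n (n - 2) := betaSq_nonneg (by omega)
  have hb1 : 0 ≤ betaSq n (n - 1) := betaSq_nonneg (by omega)
  have hfac : 0 ≤ η / 4 * (2 * (M : ℝ) + 1) := by positivity
  have hsum : (betaSq n (n - 2) + betaSq n (n - 1)) / 2 * ((xLev J M + yLev J M) ^ 2 / (4 * xLev J M * yLev J M))
      ≤ 27 / 80 * (betaSq n (n - 3) + betaSq n (n - 2)) := by
    calc (betaSq n (n - 2) + betaSq n (n - 1)) / 2 * ((xLev J M + yLev J M) ^ 2 / (4 * xLev J M * yLev J M))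
        ≤ (betaSq n (n - 2) + betaSq n (n - 1)) / 2 * (9 / 8) := mul_le_mul_of_nonneg_left hg (by positivity)
      _ ≤ 27 / 80 * (betaSq n (n - 3) + betaSq n (n - 2)) := by linarith
  calc η / 4 * (2 * (M : ℝ) + 1) * ((betaSq n (n - 2) + betaSq n (n - 1)) / 2)
        * ((xLev J M + yLev J M) ^ 2 / (4 * xLev J M * yLev J M))
      = η / 4 * (2 * (M : ℝ) + 1) * ((betaSq n (n - 2) + betaSq n (n - 1)) / 2
        * ((xLev J M + yLev J M) ^ 2 / (4 * xLev J M * yLev J M))) := by ring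
    _ ≤ η / 4 * (2 * (M : ℝ) + 1) * (27 / 80 * (betaSq n (n - 3) + betaSq n (n - 2))) :=
        mul_le_mul_of_nonneg_left hsum hfac
    _ = 27 / 80 * (η / 4 * (2 * (M : ℝ) + 1) * (betaSq n (n - 3) + betaSq n (n - 2))) := by ring

/-- **the vanished bottom level:** if sector `M+1` drops the bottom level of sector `M` (`shift = 1`), its coupling is at
most `4×` the next diagonal drop: `cU_0(M) ≤ 4 d_0`. [folklore] -/
theorem cUK_zero_le_of_shift (n M : ℕ) {η : ℝ} (hη : 0 ≤ η) (hM : M + 4 ≤ n) (hs : shift n M = 1) :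
    cUK n (M : ℤ) η 0 ≤ 4 * dK n M η 0 := by
  have hpar : M % 2 = n % 2 := by unfold shift at hs; split_ifs at hs with h; exact h
  have hj0 : lev n (M : ℤ) 0 = M := by
    unfold lev jMin; rw [Int.natAbs_natCast, if_pos hpar]; omega
  have hj1 : lev n ((M : ℤ) + 1) 0 = M + 2 := by
    unfold lev jMin; rw [natAbs_natCast_succ, if_neg (by omega)]
  rw [dK_eq_of_le n M η 0 (by omega), hj1, show M + 2 - 1 = M + 1 by omega]
  unfold cUK bSq
  rw [hj0, if_pos (by omega), if_pos (by omega)]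
  push_cast
  have hv := vanish_le (n := n) (M := M) hM
  nlinarith [mul_le_mul_of_nonneg_left hv (by positivity : (0:ℝ) ≤ η / 8)]

/-! ## The ratio bounds `T_k = ¼`, `T_top = 4/25` -/

/-- the explicit ratio bounds: `¼` below the top link, `4/25` on it. [folklore] -/
def ratioTall (N k : ℕ) : ℝ := if k + 2 < N then 1 / 4 else 4 / 25

/-- `0 ≤ T ≤ ¼`. [folklore] -/
theorem ratioTall_le (N k : ℕ) : 0 ≤ ratioTall N k ∧ ratioTall N k ≤ 1 / 4 := by
  unfold ratioTall; split_ifs <;> constructor <;> norm_num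

/-- **the brackets are positive and dominate the couplings** (`n ≥ 8`, `M + 4 ≤ n`, `0 < η ≤ 1`): hypotheses `hden`, `hT` of
`budgetCondition_of_ratioBounds` for `T = ratioTall`. [folklore] -/
theorem ratio_hypotheses {n M : ℕ} (hn : 8 ≤ n) (hM : M + 4 ≤ n) {η : ℝ} (h0 : 0 < η) (h1 : η ≤ 1) (k : ℕ)
    (hk : k + 1 < numLevels n (M : ℤ)) :
    0 < bracket (numLevels n (M : ℤ)) (pK n (M : ℤ) η) (cUK n (M : ℤ) η) (ratioTall (numLevels n (M : ℤ))) k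
    ∧ cUK n (M : ℤ) η k ≤ ratioTall (numLevels n (M : ℤ)) k
        * bracket (numLevels n (M : ℤ)) (pK n (M : ℤ) η) (cUK n (M : ℤ) η) (ratioTall (numLevels n (M : ℤ))) k := by
  have hMabs : ((M : ℤ)).natAbs ≤ n := by rw [Int.natAbs_natCast]; omega
  have hJ2 : lev n (M : ℤ) k + 2 ≤ n := lev_add_two_le n hMabs hk
  have hlevk : ∀ j, lev n (M : ℤ) j = jMin n (M : ℤ) + 2 * j := fun j => rfl
  have hcpos : 0 < cUK n (M : ℤ) η k := (cK_pos hMabs h0 hk).trans_le (cK_le_cUK n _ h0.le k)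
  have hgap := eta_PD0_le_pK_sub n M (by omega) h0.le h1 k hJ2
  have hcu := cUK_le_CU0 n M h0.le k hJ2
  -- the back term carries the frozen ratio bound 1/4
  have hback : (if k = 0 then (0:ℝ) else
        cUK n (M : ℤ) η (k - 1) * ratioTall (numLevels n (M : ℤ)) (k - 1))
      = (if k = 0 then (0:ℝ) else (1 / 4) * cUK n (M : ℤ) η (k - 1)) := by
    by_cases hk0 : k = 0
    · rw [if_pos hk0, if_pos hk0]
    · rw [if_neg hk0, if_neg hk0]
      have : ratioTall (numLevels n (M : ℤ)) (k - 1) = 1 / 4 := by unfold ratioTall; rw [if_pos (by omega)]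
      rw [this]; ring
  unfold bracket
  rw [hback]
  by_cases htop : k + 2 < numLevels n (M : ℤ)
  · -- T = 1/4: the ratio criterion
    have hT : ratioTall (numLevels n (M : ℤ)) k = 1 / 4 := by unfold ratioTall; rw [if_pos htop]
    rw [hT]
    have hcrit := ratioCriterion_M0 (n := n) (J := lev n (M : ℤ) k) (by omega) hJ2
    have hback_le : (if k = 0 then (0:ℝ) else (1 / 4) * cUK n (M : ℤ) η (k - 1))
        ≤ 4 * (η * (if 2 ≤ lev n (M : ℤ) k then CU0 n (lev n (M : ℤ) k - 2) / 16 else 0)) := by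
      by_cases hk0 : k = 0
      · rw [if_pos hk0]
        by_cases h2 : 2 ≤ lev n (M : ℤ) k
        · rw [if_pos h2]
          have := CU0_nonneg (n := n) (J := lev n (M : ℤ) k - 2) (by omega)
          positivity
        · rw [if_neg h2]; simp
      · rw [if_neg hk0]
        have h2 : 2 ≤ lev n (M : ℤ) k := by rw [hlevk]; omega
        rw [if_pos h2]
        have hlev : lev n (M : ℤ) (k - 1) = lev n (M : ℤ) k - 2 := by rw [hlevk, hlevk]; omega
        have := cUK_le_CU0 n M h0.le (k - 1) (by omega)
        rw [hlev] at this; linarith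
    have key : 4 * cUK n (M : ℤ) η k + (if k = 0 then (0:ℝ) else (1 / 4) * cUK n (M : ℤ) η (k - 1))
        ≤ pK n (M : ℤ) η (numLevels n (M : ℤ) - 1) - pK n (M : ℤ) η k := by
      have := mul_le_mul_of_nonneg_left hcrit h0.le
      nlinarith
    constructor
    · linarith
    · linarith
  · -- the top link: k = numLevels − 2, T = 4/25
    have hT : ratioTall (numLevels n (M : ℤ)) k = 4 / 25 := by unfold ratioTall; rw [if_neg htop]
    rw [hT]
    have hl := lev_add_twice_sub n hMabs (k := k) (by omega)
    have hl0 := lev_add_twice_sub n hMabs (k := 0) (by omega)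
    have hj := jMin_le_natAbs_succ n (M : ℤ)
    rw [Int.natAbs_natCast] at hj
    have hk0 : k ≠ 0 := by
      intro hk0
      rw [hlevk] at hl0; omega
    rw [if_neg hk0]
    have hJeq : lev n (M : ℤ) k = n - 2 := by omega
    have hlev : lev n (M : ℤ) (k - 1) = n - 4 := by rw [hlevk]; rw [hlevk] at hJeq; omega
    have hcu' := cUK_le_CU0 n M h0.le (k - 1) (by omega)
    rw [hlev] at hcu'
    rw [hJeq] at hcu hgap
    have hcrit := topCriterion_M0 (n := n) hn
    have key : 25 / 4 * cUK n (M : ℤ) η k + 1 / 4 * cUK n (M : ℤ) η (k - 1)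
        ≤ pK n (M : ℤ) η (numLevels n (M : ℤ) - 1) - pK n (M : ℤ) η k := by
      have := mul_le_mul_of_nonneg_left hcrit h0.le
      nlinarith
    constructor
    · linarith
    · linarith

end Summit.HubbardSuperconductivity.HubbardSuperconductivity.Theorems.AnisotropyChord.Knn
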